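import Summits.Ventures.LatticeQCDFlow.Exactness.ReversibleTwoStep
import Summits.Ventures.LatticeQCDFlow.Exactness.Phi4MetropolisPolyObsDCT
import Summits.Ventures.LatticeQCDFlow.Exactness.Phi4HMCPolyObsFloor
import HarnessLib

/-!
# HMC and the local arm observed every SECOND update: even-lag autocovariances of every polynomial observable are nonnegative, nonincreasing, convex; the two-step chain is never antithetic

HONEST FRAMING: exact (Metropolis-corrected) sampling algorithms for lattice gauge theory;
figures of merit are autocorrelation/cost numbers at stated couplings and volumes; no
continuum-physics claim.  (SCALAR calibration rung S0-A: not a gauge result.)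

Venture `LatticeQCDFlow` (cell pub-lqcd), topic `Exactness`; FANOUT row 2 (`s0-phi4`: HMC arm
`hmcOpPhi4 J λ δ N` of every step size and trajectory length; local arm `metroScan J λ ρ` with ANY
even step law with moments — neither is a positive operator in general).  NEW WORK of the cell: the
lattice instances of `Exactness/ReversibleTwoStep.lean` (`K ∘ K` is a positive reversible exact
sampler for every reversible `K`).  Nothing is cited as a fact.  Printed counterpart NAMED ONLY:
Geyer 1992 §3.3.

## What is proved (`g = f − ⟨f⟩`, `C(k) = ∫ g (Kᵏ g) e^{−S}`, `ρ(k) = C(k)/C(0)`, `f ∈ PolyObs`)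

* HMC (every `λ > 0`, real `J`, every `δ`, `N`): **`hmcPhi4_even_autocov_succ_le`**
  (`0 ≤ C(2k+2) ≤ C(2k)`), **`hmcPhi4_even_autocov_convex_logConvex`**,
  **`hmcPhi4_even_window_le`** (even-lag series summable ⇒ every window of the two-trajectory chain
  is a floor of `τ^{(2)}` and `τ^{(2)} ≥ ½ + ρ(2) ≥ ½`) — although HMC at fixed step size has no
  spectral gap and need not be positive, the chain of every second trajectory is positive: its
  autocorrelations of EVERY polynomial observable are nonnegative and decrease monotonically;
* local arm (coercive action, any even step law with moments): **`metropolisScan_even_autocov_succ_le`**,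
  **`metropolisScan_even_window_le`**.

NOT CLAIMED: anything about odd lags; any number for any run.
-/

namespace Summit.Ventures.LatticeQCDFlow.Exactness

open Real MeasureTheory Filter Finset Topology
open Summit.Ventures.LatticeQCDFlow.Scoring

section Lattice

variable {n : ℕ}

/-- `f − c ∈ PolyObs` (local copy of `polyObs_sub_const` from `Phi4HMCPolyObsFloor`). -/
private theorem polyObs_sub_const₄ {f : (Fin (n + 1) → ℝ) → ℝ} (hf : PolyObs f) (c : ℝ) :
    PolyObs (fun φ => f φ - c) := by
  have h := polyObs_add_mul hf (polyObs_const 1) (-c)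
  have e : (fun φ => f φ + -c * (1 : ℝ)) = fun φ => f φ - c := funext fun φ => by ring
  rw [e] at h
  exact h

/-! ## §1 HMC, every step size and trajectory length -/

/-- **HMC: EVEN-LAG AUTOCOVARIANCES ARE NONNEGATIVE AND NONINCREASING** — every `λ > 0`, real `J`,
every `δ`, `N`, every `f ∈ PolyObs`, every `k`:  `0 ≤ C(2k+2) ≤ C(2k)`. -/
theorem hmcPhi4_even_autocov_succ_le {lam : ℝ} (hlam : 0 < lam) (J : Fin (n + 1) → Fin (n + 1) → ℝ)
    (δ : ℝ) (N : ℕ) {f : (Fin (n + 1) → ℝ) → ℝ} (hf : PolyObs f) (k : ℕ) :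
    0 ≤ ∫ φ, (f φ - gibbsExpect J lam f)
        * ((hmcOpPhi4 J lam δ N)^[2 * k + 2] (fun ψ => f ψ - gibbsExpect J lam f)) φ
        * gibbsWeight J lam φ ∧
    ∫ φ, (f φ - gibbsExpect J lam f)
        * ((hmcOpPhi4 J lam δ N)^[2 * k + 2] (fun ψ => f ψ - gibbsExpect J lam f)) φ
        * gibbsWeight J lam φ
      ≤ ∫ φ, (f φ - gibbsExpect J lam f)
        * ((hmcOpPhi4 J lam δ N)^[2 * k] (fun ψ => f ψ - gibbsExpect J lam f)) φ
        * gibbsWeight J lam φ := by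
  have hco := latticePhi4Action_coercive hlam J
  obtain ⟨C, hC1, hCg⟩ := hmcProposal_growth J lam δ N
  have hC : 0 ≤ C := zero_le_one.trans hC1
  have hΨm := measurable_hmcProposal (Λ := Fin (n + 1)) J lam δ N
  have hΨi := hmcProposal_involutive (Λ := Fin (n + 1)) J lam δ N
  have hΨμ := measurePreserving_hmcProposal (Λ := Fin (n + 1)) J lam δ N
  have hg : PolyObs (fun ψ => f ψ - gibbsExpect J lam f) := polyObs_sub_const₄ hf _
  exact RevOp.autocov_even_succ_le (μ := volume) (A := PolyObs)
    (K := hmcOpOf J lam (hmcProposal J lam δ N)) (w := gibbsWeight J lam)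
    (fun φ => (gibbsWeight_pos J lam φ).le)
    (fun f h hf hh => polyObs_integrable_mul_mul_gibbsWeight one_pos hco hf hh)
    (fun f h c hf hh => polyObs_add_mul hf hh c)
    (fun f hf => polyObs_hmcOpOf J lam hΨm hC hCg hf)
    (fun f h c hf hh x => hmcOpOf_add_mul_poly J lam hΨm hC hCg hf hh c x)
    (fun f h hf hh => hmc_reversible_poly one_pos hco hΨm hΨi hΨμ hf hh)
    (fun f hf => hmcOpOf_contraction_poly one_pos hco hΨm hΨi hΨμ hC hCg hf) hg k

/-- **HMC: even lags are CONVEX and LOG-CONVEX** — `C(2k+2) − C(2k+4) ≤ C(2k) − C(2k+2)` and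
`C(2k+2)² ≤ C(2k) C(2k+4)`, every `δ`, `N`, `f ∈ PolyObs`. -/
theorem hmcPhi4_even_autocov_convex_logConvex {lam : ℝ} (hlam : 0 < lam)
    (J : Fin (n + 1) → Fin (n + 1) → ℝ) (δ : ℝ) (N : ℕ) {f : (Fin (n + 1) → ℝ) → ℝ} (hf : PolyObs f)
    (k : ℕ) :
    (∫ φ, (f φ - gibbsExpect J lam f)
        * ((hmcOpPhi4 J lam δ N)^[2 * k + 2] (fun ψ => f ψ - gibbsExpect J lam f)) φ
        * gibbsWeight J lam φ)
      - ∫ φ, (f φ - gibbsExpect J lam f)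
        * ((hmcOpPhi4 J lam δ N)^[2 * k + 4] (fun ψ => f ψ - gibbsExpect J lam f)) φ
        * gibbsWeight J lam φ
      ≤ (∫ φ, (f φ - gibbsExpect J lam f)
        * ((hmcOpPhi4 J lam δ N)^[2 * k] (fun ψ => f ψ - gibbsExpect J lam f)) φ
        * gibbsWeight J lam φ)
      - ∫ φ, (f φ - gibbsExpect J lam f)
        * ((hmcOpPhi4 J lam δ N)^[2 * k + 2] (fun ψ => f ψ - gibbsExpect J lam f)) φ
        * gibbsWeight J lam φ ∧
    (∫ φ, (f φ - gibbsExpect J lam f)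
        * ((hmcOpPhi4 J lam δ N)^[2 * k + 2] (fun ψ => f ψ - gibbsExpect J lam f)) φ
        * gibbsWeight J lam φ) ^ 2
      ≤ (∫ φ, (f φ - gibbsExpect J lam f)
        * ((hmcOpPhi4 J lam δ N)^[2 * k] (fun ψ => f ψ - gibbsExpect J lam f)) φ
        * gibbsWeight J lam φ)
        * ∫ φ, (f φ - gibbsExpect J lam f)
        * ((hmcOpPhi4 J lam δ N)^[2 * k + 4] (fun ψ => f ψ - gibbsExpect J lam f)) φ
        * gibbsWeight J lam φ := by
  have hco := latticePhi4Action_coercive hlam J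
  obtain ⟨C, hC1, hCg⟩ := hmcProposal_growth J lam δ N
  have hC : 0 ≤ C := zero_le_one.trans hC1
  have hΨm := measurable_hmcProposal (Λ := Fin (n + 1)) J lam δ N
  have hΨi := hmcProposal_involutive (Λ := Fin (n + 1)) J lam δ N
  have hΨμ := measurePreserving_hmcProposal (Λ := Fin (n + 1)) J lam δ N
  have hg : PolyObs (fun ψ => f ψ - gibbsExpect J lam f) := polyObs_sub_const₄ hf _
  exact RevOp.autocov_even_convex_logConvex (μ := volume) (A := PolyObs)
    (K := hmcOpOf J lam (hmcProposal J lam δ N)) (w := gibbsWeight J lam)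
    (fun φ => (gibbsWeight_pos J lam φ).le)
    (fun f h hf hh => polyObs_integrable_mul_mul_gibbsWeight one_pos hco hf hh)
    (fun f h c hf hh => polyObs_add_mul hf hh c)
    (fun f hf => polyObs_hmcOpOf J lam hΨm hC hCg hf)
    (fun f h c hf hh x => hmcOpOf_add_mul_poly J lam hΨm hC hCg hf hh c x)
    (fun f h hf hh => hmc_reversible_poly one_pos hco hΨm hΨi hΨμ hf hh) hg k

/-- **HMC OBSERVED EVERY SECOND TRAJECTORY IS NEVER ANTITHETIC; ITS WINDOWS ARE FLOORS**: if the
even-lag series `k ↦ ρ(2k)` of `f ∈ PolyObs` is summable, then every window of the two-trajectory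
chain is `≤ τ^{(2)}` and `½ ≤ ½ + ρ(2) ≤ τ^{(2)}`. -/
theorem hmcPhi4_even_window_le {lam : ℝ} (hlam : 0 < lam) (J : Fin (n + 1) → Fin (n + 1) → ℝ)
    (δ : ℝ) (N : ℕ) {f : (Fin (n + 1) → ℝ) → ℝ} (hf : PolyObs f)
    (hs : Summable fun k => (∫ φ, (f φ - gibbsExpect J lam f)
        * ((hmcOpPhi4 J lam δ N)^[2 * (k + 1)] (fun ψ => f ψ - gibbsExpect J lam f)) φ
        * gibbsWeight J lam φ) / ∫ φ, (f φ - gibbsExpect J lam f) ^ 2 * gibbsWeight J lam φ)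
    (W : ℕ) :
    tauIntWindow (fun k => (∫ φ, (f φ - gibbsExpect J lam f)
        * ((hmcOpPhi4 J lam δ N)^[2 * k] (fun ψ => f ψ - gibbsExpect J lam f)) φ
        * gibbsWeight J lam φ) / ∫ φ, (f φ - gibbsExpect J lam f) ^ 2 * gibbsWeight J lam φ) W
      ≤ tauInt (fun k => (∫ φ, (f φ - gibbsExpect J lam f)
        * ((hmcOpPhi4 J lam δ N)^[2 * k] (fun ψ => f ψ - gibbsExpect J lam f)) φ
        * gibbsWeight J lam φ) / ∫ φ, (f φ - gibbsExpect J lam f) ^ 2 * gibbsWeight J lam φ) ∧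
    (1 / 2 ≤ 1 / 2 + (∫ φ, (f φ - gibbsExpect J lam f)
        * ((hmcOpPhi4 J lam δ N)^[2] (fun ψ => f ψ - gibbsExpect J lam f)) φ
        * gibbsWeight J lam φ) / (∫ φ, (f φ - gibbsExpect J lam f) ^ 2 * gibbsWeight J lam φ) ∧
      1 / 2 + (∫ φ, (f φ - gibbsExpect J lam f)
        * ((hmcOpPhi4 J lam δ N)^[2] (fun ψ => f ψ - gibbsExpect J lam f)) φ
        * gibbsWeight J lam φ) / (∫ φ, (f φ - gibbsExpect J lam f) ^ 2 * gibbsWeight J lam φ)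
      ≤ tauInt (fun k => (∫ φ, (f φ - gibbsExpect J lam f)
        * ((hmcOpPhi4 J lam δ N)^[2 * k] (fun ψ => f ψ - gibbsExpect J lam f)) φ
        * gibbsWeight J lam φ) / ∫ φ, (f φ - gibbsExpect J lam f) ^ 2 * gibbsWeight J lam φ)) := by
  have hco := latticePhi4Action_coercive hlam J
  obtain ⟨C, hC1, hCg⟩ := hmcProposal_growth J lam δ N
  have hC : 0 ≤ C := zero_le_one.trans hC1
  have hΨm := measurable_hmcProposal (Λ := Fin (n + 1)) J lam δ N
  have hΨi := hmcProposal_involutive (Λ := Fin (n + 1)) J lam δ N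
  have hΨμ := measurePreserving_hmcProposal (Λ := Fin (n + 1)) J lam δ N
  have hg : PolyObs (fun ψ => f ψ - gibbsExpect J lam f) := polyObs_sub_const₄ hf _
  exact RevOp.even_tauIntWindow_le (μ := volume) (A := PolyObs)
    (K := hmcOpOf J lam (hmcProposal J lam δ N)) (w := gibbsWeight J lam)
    (fun φ => (gibbsWeight_pos J lam φ).le)
    (fun f hf => polyObs_hmcOpOf J lam hΨm hC hCg hf)
    (fun f h hf hh => hmc_reversible_poly one_pos hco hΨm hΨi hΨμ hf hh) hg hs W

/-! ## §2 The local arm, any step law -/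

/-- **LOCAL ARM: EVEN-LAG AUTOCOVARIANCES ARE NONNEGATIVE AND NONINCREASING** — coercive action,
ANY even step law with all moments (the uniform window included), every `f ∈ PolyObs`, every `k`. -/
theorem metropolisScan_even_autocov_succ_le {J : Fin (n + 1) → Fin (n + 1) → ℝ} {lam ε K : ℝ}
    (hε : 0 < ε) (hS : ∀ φ : Fin (n + 1) → ℝ, ε * ∑ w, φ w ^ 2 - K ≤ latticePhi4Action J lam φ)
    {ρ : ℝ → ℝ} (hρ0 : ∀ u, 0 ≤ ρ u) (hρm : Measurable ρ) (hρi : Integrable ρ)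
    (hρ1 : ∫ u, ρ u = 1) (hρs : ∀ u, ρ (-u) = ρ u)
    (hρmom : ∀ j : ℕ, Integrable (fun u => (1 + |u|) ^ j * ρ u))
    {f : (Fin (n + 1) → ℝ) → ℝ} (hf : PolyObs f) (k : ℕ) :
    0 ≤ ∫ φ, (f φ - gibbsExpect J lam f)
        * ((metroScan J lam ρ)^[2 * k + 2] (fun ψ => f ψ - gibbsExpect J lam f)) φ
        * gibbsWeight J lam φ ∧
    ∫ φ, (f φ - gibbsExpect J lam f)
        * ((metroScan J lam ρ)^[2 * k + 2] (fun ψ => f ψ - gibbsExpect J lam f)) φ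
        * gibbsWeight J lam φ
      ≤ ∫ φ, (f φ - gibbsExpect J lam f)
        * ((metroScan J lam ρ)^[2 * k] (fun ψ => f ψ - gibbsExpect J lam f)) φ
        * gibbsWeight J lam φ := by
  have hg : PolyObs (fun ψ => f ψ - gibbsExpect J lam f) := polyObs_sub_const₄ hf _
  exact RevOp.autocov_even_succ_le (μ := volume) (A := PolyObs) (K := metroScan J lam ρ)
    (w := gibbsWeight J lam) (fun φ => (gibbsWeight_pos J lam φ).le)
    (fun f h hf hh => polyObs_integrable_mul_mul_gibbsWeight hε hS hf hh)
    (fun f h c hf hh => polyObs_add_mul hf hh c)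
    (fun f hf => polyObs_metroScan J lam hρ0 hρm hρmom hf)
    (fun f h c hf hh x => metroScan_add_mul_poly J lam hρ0 hρm hρmom hf hh c x)
    (fun f h hf hh => metroScan_reversible_poly hε hS hρ0 hρm hρi hρ1 hρs hρmom hf hh)
    (fun f hf => metroScan_contraction_poly hε hS hρ0 hρm hρi hρ1 hρs hρmom hf) hg k

/-- **LOCAL ARM OBSERVED EVERY SECOND PROPOSAL: windows are floors, never antithetic** — any even
step law with moments; even-lag series summable. -/
theorem metropolisScan_even_window_le {J : Fin (n + 1) → Fin (n + 1) → ℝ} {lam ε K : ℝ}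
    (hε : 0 < ε) (hS : ∀ φ : Fin (n + 1) → ℝ, ε * ∑ w, φ w ^ 2 - K ≤ latticePhi4Action J lam φ)
    {ρ : ℝ → ℝ} (hρ0 : ∀ u, 0 ≤ ρ u) (hρm : Measurable ρ) (hρi : Integrable ρ)
    (hρ1 : ∫ u, ρ u = 1) (hρs : ∀ u, ρ (-u) = ρ u)
    (hρmom : ∀ j : ℕ, Integrable (fun u => (1 + |u|) ^ j * ρ u))
    {f : (Fin (n + 1) → ℝ) → ℝ} (hf : PolyObs f)
    (hs : Summable fun k => (∫ φ, (f φ - gibbsExpect J lam f)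
        * ((metroScan J lam ρ)^[2 * (k + 1)] (fun ψ => f ψ - gibbsExpect J lam f)) φ
        * gibbsWeight J lam φ) / ∫ φ, (f φ - gibbsExpect J lam f) ^ 2 * gibbsWeight J lam φ)
    (W : ℕ) :
    tauIntWindow (fun k => (∫ φ, (f φ - gibbsExpect J lam f)
        * ((metroScan J lam ρ)^[2 * k] (fun ψ => f ψ - gibbsExpect J lam f)) φ
        * gibbsWeight J lam φ) / ∫ φ, (f φ - gibbsExpect J lam f) ^ 2 * gibbsWeight J lam φ) W
      ≤ tauInt (fun k => (∫ φ, (f φ - gibbsExpect J lam f)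
        * ((metroScan J lam ρ)^[2 * k] (fun ψ => f ψ - gibbsExpect J lam f)) φ
        * gibbsWeight J lam φ) / ∫ φ, (f φ - gibbsExpect J lam f) ^ 2 * gibbsWeight J lam φ) ∧
    (1 / 2 ≤ 1 / 2 + (∫ φ, (f φ - gibbsExpect J lam f)
        * ((metroScan J lam ρ)^[2] (fun ψ => f ψ - gibbsExpect J lam f)) φ
        * gibbsWeight J lam φ) / (∫ φ, (f φ - gibbsExpect J lam f) ^ 2 * gibbsWeight J lam φ) ∧
      1 / 2 + (∫ φ, (f φ - gibbsExpect J lam f)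
        * ((metroScan J lam ρ)^[2] (fun ψ => f ψ - gibbsExpect J lam f)) φ
        * gibbsWeight J lam φ) / (∫ φ, (f φ - gibbsExpect J lam f) ^ 2 * gibbsWeight J lam φ)
      ≤ tauInt (fun k => (∫ φ, (f φ - gibbsExpect J lam f)
        * ((metroScan J lam ρ)^[2 * k] (fun ψ => f ψ - gibbsExpect J lam f)) φ
        * gibbsWeight J lam φ) / ∫ φ, (f φ - gibbsExpect J lam f) ^ 2 * gibbsWeight J lam φ)) := by
  have hg : PolyObs (fun ψ => f ψ - gibbsExpect J lam f) := polyObs_sub_const₄ hf _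
  exact RevOp.even_tauIntWindow_le (μ := volume) (A := PolyObs) (K := metroScan J lam ρ)
    (w := gibbsWeight J lam) (fun φ => (gibbsWeight_pos J lam φ).le)
    (fun f hf => polyObs_metroScan J lam hρ0 hρm hρmom hf)
    (fun f h hf hh => metroScan_reversible_poly hε hS hρ0 hρm hρi hρ1 hρs hρmom hf hh) hg hs W

end Lattice

end Summit.Ventures.LatticeQCDFlow.Exactness
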